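import Summits.ValiantsHypothesis.ValiantsHypothesis.Theorems.LacunarySymmetroidMatrixDescartesStubDescartesCeiling
import Summits.ValiantsHypothesis.ValiantsHypothesis.Theorems.LacunarySymmetroidMatrixDescartesCensusDoorA34SheetDefiniteLetterCells

/-!
# `MatrixDescartes` (stmt-ValiantsHypothesis-18050) — TRAILING COEFFICIENTS OF A LACUNARY PENCIL (any size, any letters)
# and the adjugate of a PSD matrix

HONEST FRAMING.  Cell `pub-symmetroid`, seat `val-sym-mdr-p2` (gen 26); helper file `--supports` the crux
`Theses.LacunarySymmetroid.MatrixDescartes` (OPEN), NO closure claim.  Pure bookkeeping about ONE real lacunary pencil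
`F = ∑ l, X^{d l} • S l` with ARBITRARY real `m × m` letters `S l` (no symmetry, no semidefiniteness), used by the companion
`…WLawNotSharp` (the four-letter column is never Descartes-sharp); nothing here bears on `MatrixDescartes` in its window, on
`stub_twoSided`, on `DoorA26` / `DoorA34`, on the cell's registers, or on `VP ≠ VNP`.

WHAT IS PROVED (ns `TrailingCoeffs`).
* `coeff_det_pencil_eq` — the coefficient of `X^n` in `det F` as the signed sum of the Leibniz products `∏ᵢ S (f i) (σ i) i` over the
  row-to-letter maps `f` of exponent `∑ᵢ d (f i) = n` (from the tree's `StubDescartesCeiling.det_pencil_eq`).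
* **`coeff_det_pencil_bot`** — if the letter `l₀` carries the strictly smallest exponent, the coefficient of `X^{m · d l₀}` is `det (S l₀)`
  (only the constant map has that exponent, `mul_lt_sum_of_ne_const`).
* **`coeff_det_pencil_botNext`** — if moreover `l₁` carries the strictly second smallest exponent (size `m + 1`), the coefficient of
  `X^{m · d l₀ + d l₁}` is `tr (adj (S l₀) · S l₁)`: the maps of that exponent are exactly the ONE-OFF maps (all rows in `l₀` but one in
  `l₁`, `sum_eq_botNext_iff`), and the Leibniz sum of a one-off map is a Cramer determinant `= (adj (S l₀) · S l₁) i₀ i₀`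
  (`leibniz_update_eq_adjugate_mul`); **`botNext_lt_of_mem_support`** — every other exponent of the support is larger.
* **`trace_adjugate_mul_nonneg`** (`P, Q ⪰ 0 ⇒ 0 ≤ tr (adj P · Q)`, from the tree's `Census.adjugate_posSemidef_of_posSemidef`,
  `adj P ⪰ 0`): the two trailing coefficients of a pencil whose two lowest letters are PSD are non-negative.
By reflection of exponents the same statements hold for the two LEADING coefficients (not filed).

[folklore] Leibniz expansion, Cramer's rule / adjugate (Mathlib `Matrix.cramer_apply`, `Matrix.cramer_eq_adjugate_mulVec`,
tree `Census.adjugate_posSemidef_of_posSemidef`), the C⋆-order factorisation of PSD matrices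
(`CStarAlgebra.nonneg_iff_eq_star_mul_self` under `open scoped MatrixOrder`).  No definitions, no named facts.
-/

-- `Summit.ValiantsHypothesis.ValiantsHypothesis.…` repeats a component by the single-conjunct
-- summit layout, which the `dupNamespace` linter flags; the name is mandated.
set_option linter.dupNamespace false

namespace Summit.ValiantsHypothesis.ValiantsHypothesis.Theorems.LacunarySymmetroidMatrixDescartes

open Polynomial Finset Matrix
open scoped BigOperators Polynomial Matrix MatrixOrder

namespace TrailingCoeffs

/-! ### 1. `tr (adj P · Q) ≥ 0` for PSD `P, Q` (the adjugate of a PSD matrix is PSD: tree `Census.adjugate_posSemidef_of_posSemidef`) -/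

/-- `P, Q ⪰ 0 ⇒ 0 ≤ tr (adj P · Q)` (`Q = Dᴴ D`, `tr (adj P · Dᴴ D) = tr (D · adj P · Dᴴ) ≥ 0`). [folklore] -/
theorem trace_adjugate_mul_nonneg {n : Type*} [Fintype n] [DecidableEq n] {P Q : Matrix n n ℝ}
    (hP : P.PosSemidef) (hQ : Q.PosSemidef) : 0 ≤ (P.adjugate * Q).trace := by
  obtain ⟨D, hD⟩ := CStarAlgebra.nonneg_iff_eq_star_mul_self.mp hQ.nonneg
  rw [hD, Matrix.star_eq_conjTranspose, ← Matrix.mul_assoc, Matrix.trace_mul_comm]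
  have h := (Census.adjugate_posSemidef_of_posSemidef hP).mul_mul_conjTranspose_same D
  rw [Matrix.mul_assoc] at h
  exact h.trace_nonneg

/-! ### 2. Trailing coefficients of a lacunary pencil (any size, any number of letters, arbitrary real letters) -/

variable {K m : ℕ}

/-- Coefficients of `det (∑ l, X^{d l} • S l)` from the Leibniz expansion (tree `StubDescartesCeiling.det_pencil_eq`):
the coefficient of `X^n` is the signed sum of the Leibniz products `∏ᵢ S (f i) (σ i) i` over the row-to-letter maps `f`
with `∑ᵢ d (f i) = n`. [folklore] -/
theorem coeff_det_pencil_eq (d : Fin K → ℕ) (S : Fin K → Matrix (Fin m) (Fin m) ℝ) (n : ℕ) :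
    (Matrix.det (∑ l, ((X : ℝ[X]) ^ d l) • (S l).map C)).coeff n
      = ∑ σ : Equiv.Perm (Fin m), ∑ f : Fin m → Fin K,
          if n = ∑ i, d (f i) then ((Equiv.Perm.sign σ : ℤ) : ℝ) * ∏ i, S (f i) (σ i) i else 0 := by
  rw [StubDescartesCeiling.det_pencil_eq, finsetSum_coeff]
  refine Finset.sum_congr rfl fun σ _ => ?_
  rw [finsetSum_coeff]
  refine Finset.sum_congr rfl fun f _ => ?_
  rw [← C_eq_intCast, ← mul_assoc, ← C_mul, coeff_C_mul_X_pow]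

/-- The constant row-to-letter map has exponent `m · d l₀`. [folklore] -/
theorem sum_const_letter (d : Fin K → ℕ) (l₀ : Fin K) : (∑ _i : Fin m, d l₀) = m * d l₀ := by
  simp

/-- If the letter `l₀` carries the strictly smallest exponent, every non-constant row-to-letter map has exponent `> m · d l₀`. [folklore] -/
theorem mul_lt_sum_of_ne_const (d : Fin K → ℕ) {l₀ : Fin K} (hbot : ∀ l, l ≠ l₀ → d l₀ < d l)
    {f : Fin m → Fin K} (hf : f ≠ fun _ => l₀) : m * d l₀ < ∑ i, d (f i) := by
  obtain ⟨i₀, hi₀⟩ : ∃ i, f i ≠ l₀ := by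
    by_contra h
    push Not at h
    exact hf (funext h)
  rw [← sum_const_letter d l₀]
  refine Finset.sum_lt_sum (fun i _ => ?_) ⟨i₀, Finset.mem_univ _, hbot _ hi₀⟩
  by_cases h : f i = l₀
  · rw [h]
  · exact (hbot _ h).le

/-- **Trailing coefficient of a lacunary pencil.**  If the letter `l₀` carries the strictly smallest exponent then the coefficient
of `X^{m · d l₀}` in `det (∑ l, X^{d l} • S l)` is `det (S l₀)` (only the constant row-to-letter map contributes). [folklore] -/
theorem coeff_det_pencil_bot (d : Fin K → ℕ) (S : Fin K → Matrix (Fin m) (Fin m) ℝ) {l₀ : Fin K}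
    (hbot : ∀ l, l ≠ l₀ → d l₀ < d l) :
    (Matrix.det (∑ l, ((X : ℝ[X]) ^ d l) • (S l).map C)).coeff (m * d l₀) = (S l₀).det := by
  rw [coeff_det_pencil_eq, Matrix.det_apply']
  refine Finset.sum_congr rfl fun σ _ => ?_
  rw [Finset.sum_eq_single (fun _ => l₀)]
  · rw [if_pos (sum_const_letter d l₀).symm]
  · intro f _ hf
    rw [if_neg (mul_lt_sum_of_ne_const d hbot hf).ne]
  · intro h; exact absurd (Finset.mem_univ _) h

/-- The one-off row-to-letter maps: all rows in the letter `l₀` except row `i₀` in the letter `l₁`. [folklore] -/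
theorem sum_update_letter (d : Fin K → ℕ) (l₀ l₁ : Fin K) (i₀ : Fin (m + 1)) :
    (∑ i, d (Function.update (fun _ : Fin (m + 1) => l₀) i₀ l₁ i)) = m * d l₀ + d l₁ := by
  have h : (fun i => d (Function.update (fun _ : Fin (m + 1) => l₀) i₀ l₁ i))
      = Function.update (fun _ : Fin (m + 1) => d l₀) i₀ (d l₁) := by
    funext i
    rw [Function.apply_update (fun _ => d)]
  rw [show (∑ i, d (Function.update (fun _ : Fin (m + 1) => l₀) i₀ l₁ i))
      = ∑ i, (fun i => d (Function.update (fun _ : Fin (m + 1) => l₀) i₀ l₁ i)) i from rfl, h,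
    Finset.sum_update_of_mem (Finset.mem_univ i₀)]
  simp [Finset.card_univ_sdiff, add_comm]

/-- **Characterisation of the second trailing exponent.**  If `l₀` carries the strictly smallest and `l₁` the strictly second
smallest exponent (size `m + 1`), a row-to-letter map has exponent `m · d l₀ + d l₁` iff it is a one-off map. [folklore] -/
theorem sum_eq_botNext_iff (d : Fin K → ℕ) {l₀ l₁ : Fin K} (h01 : d l₀ < d l₁)
    (hnext : ∀ l, l ≠ l₀ → l ≠ l₁ → d l₁ < d l) (f : Fin (m + 1) → Fin K) :
    (m * d l₀ + d l₁ = ∑ i, d (f i)) ↔ ∃ i₀, f = Function.update (fun _ => l₀) i₀ l₁ := by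
  constructor
  · intro hsum
    -- every non-`l₀` row costs at least `d l₁`
    have hge : ∀ i, f i ≠ l₀ → d l₁ ≤ d (f i) := fun i hi => by
      by_cases h1 : f i = l₁
      · rw [h1]
      · exact (hnext _ hi h1).le
    have hge0 : ∀ i, d l₀ ≤ d (f i) := fun i => by
      by_cases h0 : f i = l₀
      · rw [h0]
      · exact h01.le.trans (hge i h0)
    -- some row is not in `l₀`
    obtain ⟨i₀, hi₀⟩ : ∃ i, f i ≠ l₀ := by
      by_contra h
      push Not at h
      have : (∑ i, d (f i)) = (m + 1) * d l₀ := by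
        rw [show f = fun _ => l₀ from funext h]; exact sum_const_letter d l₀
      rw [this] at hsum
      nlinarith
    -- no second row is outside `l₀`
    have hothers : ∀ i, i ≠ i₀ → f i = l₀ := by
      intro i₁ hi₁
      by_contra hne
      have hsplit := (Finset.add_sum_erase (Finset.univ) (fun i => d (f i)) (Finset.mem_univ i₀))
      have hmem : i₁ ∈ Finset.univ.erase i₀ := Finset.mem_erase.mpr ⟨hi₁, Finset.mem_univ _⟩
      have hsplit2 := (Finset.add_sum_erase _ (fun i => d (f i)) hmem)
      have hrest : (Finset.univ.erase i₀ |>.erase i₁).card * d l₀ ≤ ∑ i ∈ (Finset.univ.erase i₀).erase i₁, d (f i) := by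
        rw [← smul_eq_mul, ← Finset.sum_const]
        exact Finset.sum_le_sum fun i _ => hge0 i
      have hcard : ((Finset.univ : Finset (Fin (m + 1))).erase i₀ |>.erase i₁).card = m - 1 := by
        rw [Finset.card_erase_of_mem hmem, Finset.card_erase_of_mem (Finset.mem_univ _), Finset.card_univ,
          Fintype.card_fin]
        omega
      rw [hcard] at hrest
      have h1 := hge i₀ hi₀
      have h2 := hge i₁ hne
      have hm : 1 ≤ m := by
        rcases Nat.eq_zero_or_pos m with hm0 | hm0
        · subst hm0
          have hlt₁ := i₁.isLt; have hlt₀ := i₀.isLt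
          exact absurd (Fin.ext (by omega)) hi₁
        · exact hm0
      have key : (m - 1) * d l₀ + d l₀ = m * d l₀ := by
        rw [← Nat.succ_mul]; congr 1; omega
      rw [← hsplit, ← hsplit2] at hsum
      nlinarith
    refine ⟨i₀, funext fun i => ?_⟩
    by_cases hi : i = i₀
    · subst hi
      rw [Function.update_self]
      -- the exponent forces `d (f i) = d l₁`, hence `f i = l₁`
      by_contra hne
      have hlt := hnext _ hi₀ hne
      have heq : (∑ j, d (f j)) = m * d l₀ + d (f i) := by
        have : f = Function.update (fun _ => l₀) i (f i) := by
          funext j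
          by_cases hj : j = i
          · subst hj; rw [Function.update_self]
          · rw [Function.update_of_ne hj, hothers j hj]
        conv_lhs => rw [this]
        exact sum_update_letter d l₀ (f i) i
      rw [heq] at hsum
      omega
    · rw [Function.update_of_ne hi, hothers i hi]
  · rintro ⟨i₀, rfl⟩
    exact (sum_update_letter d l₀ l₁ i₀).symm

/-- The one-off maps are pairwise distinct. [folklore] -/
theorem update_letter_injective {l₀ l₁ : Fin K} (h : l₀ ≠ l₁) :
    Function.Injective (fun i₀ : Fin (m + 1) => Function.update (fun _ : Fin (m + 1) => l₀) i₀ l₁) := by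
  intro i j hij
  by_contra hne
  have := congrFun hij i
  simp only [Function.update_self, Function.update_of_ne hne] at this
  exact h this.symm

/-- The Leibniz sum of a one-off map is the determinant of `S l₀` with column `i₀` taken from `S l₁`, i.e. the diagonal entry
`(adj (S l₀) · S l₁) i₀ i₀` (Cramer). [folklore] -/
theorem leibniz_update_eq_adjugate_mul (S : Fin K → Matrix (Fin (m + 1)) (Fin (m + 1)) ℝ) (l₀ l₁ : Fin K) (i₀ : Fin (m + 1)) :
    (∑ σ : Equiv.Perm (Fin (m + 1)), ((Equiv.Perm.sign σ : ℤ) : ℝ) *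
        ∏ i, S (Function.update (fun _ => l₀) i₀ l₁ i) (σ i) i)
      = ((S l₀).adjugate * S l₁) i₀ i₀ := by
  have hM : (Matrix.of fun a b => S (Function.update (fun _ => l₀) i₀ l₁ b) a b)
      = (S l₀).updateCol i₀ (fun a => S l₁ a i₀) := by
    ext a b
    by_cases hb : b = i₀
    · subst hb; simp
    · simp [Matrix.updateCol_ne hb, Function.update_of_ne hb]
  rw [show (∑ σ : Equiv.Perm (Fin (m + 1)), ((Equiv.Perm.sign σ : ℤ) : ℝ) *
        ∏ i, S (Function.update (fun _ => l₀) i₀ l₁ i) (σ i) i)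
      = (Matrix.of fun a b => S (Function.update (fun _ => l₀) i₀ l₁ b) a b).det by
      rw [Matrix.det_apply']; rfl, hM, ← Matrix.cramer_apply, Matrix.cramer_eq_adjugate_mulVec,
    Matrix.mulVec, Matrix.mul_apply]
  rfl

/-- **Second trailing coefficient of a lacunary pencil.**  If `l₀` carries the strictly smallest and `l₁` the strictly second
smallest exponent (size `m + 1`), the coefficient of `X^{m · d l₀ + d l₁}` in `det (∑ l, X^{d l} • S l)` is `tr (adj (S l₀) · S l₁)`.
[folklore] -/
theorem coeff_det_pencil_botNext (d : Fin K → ℕ) (S : Fin K → Matrix (Fin (m + 1)) (Fin (m + 1)) ℝ) {l₀ l₁ : Fin K}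
    (h01 : d l₀ < d l₁) (hnext : ∀ l, l ≠ l₀ → l ≠ l₁ → d l₁ < d l) :
    (Matrix.det (∑ l, ((X : ℝ[X]) ^ d l) • (S l).map C)).coeff (m * d l₀ + d l₁) = ((S l₀).adjugate * S l₁).trace := by
  classical
  have hl : l₀ ≠ l₁ := fun h => by rw [h] at h01; exact lt_irrefl _ h01
  rw [coeff_det_pencil_eq]
  have hinner : ∀ σ : Equiv.Perm (Fin (m + 1)),
      (∑ f : Fin (m + 1) → Fin K, if m * d l₀ + d l₁ = ∑ i, d (f i)
          then ((Equiv.Perm.sign σ : ℤ) : ℝ) * ∏ i, S (f i) (σ i) i else 0)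
        = ∑ i₀ : Fin (m + 1), ((Equiv.Perm.sign σ : ℤ) : ℝ) *
            ∏ i, S (Function.update (fun _ => l₀) i₀ l₁ i) (σ i) i := by
    intro σ
    rw [← Finset.sum_filter]
    have hset : (Finset.univ : Finset (Fin (m + 1) → Fin K)).filter (fun f => m * d l₀ + d l₁ = ∑ i, d (f i))
        = Finset.univ.image (fun i₀ : Fin (m + 1) => Function.update (fun _ : Fin (m + 1) => l₀) i₀ l₁) := by
      ext f
      simp only [Finset.mem_filter, Finset.mem_univ, true_and, Finset.mem_image]
      rw [sum_eq_botNext_iff d h01 hnext f]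
      constructor
      · rintro ⟨i₀, rfl⟩; exact ⟨i₀, rfl⟩
      · rintro ⟨i₀, rfl⟩; exact ⟨i₀, rfl⟩
    rw [hset, Finset.sum_image fun i _ j _ hij => update_letter_injective hl hij]
  simp_rw [hinner]
  rw [Finset.sum_comm]
  simp_rw [leibniz_update_eq_adjugate_mul]
  rfl

/-- **Support above the two trailing exponents.**  Under the same hypotheses every exponent of the support of the pencil
determinant other than `(m+1) · d l₀` and `m · d l₀ + d l₁` exceeds `m · d l₀ + d l₁` (the hypothesis on `l₀` is implied:
`d l₀ < d l₁ < d l`). [folklore] -/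
theorem botNext_lt_of_mem_support (d : Fin K → ℕ) (S : Fin K → Matrix (Fin (m + 1)) (Fin (m + 1)) ℝ) {l₀ l₁ : Fin K}
    (h01 : d l₀ < d l₁) (hnext : ∀ l, l ≠ l₀ → l ≠ l₁ → d l₁ < d l) {E : ℕ}
    (hE : E ∈ (Matrix.det (∑ l, ((X : ℝ[X]) ^ d l) • (S l).map C)).support) (hE0 : E ≠ (m + 1) * d l₀)
    (hE1 : E ≠ m * d l₀ + d l₁) : m * d l₀ + d l₁ < E := by
  classical
  by_contra hle
  push Not at hle
  refine (mem_support_iff.mp hE) (StubDescartesCeiling.coeff_det_pencil_eq_zero d S fun f hf => ?_)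
  -- `f` would be a map of exponent `E ≤ m·d l₀ + d l₁`, distinct from both trailing exponents
  by_cases hc : f = fun _ => l₀
  · subst hc; rw [sum_const_letter] at hf; exact hE0 hf.symm
  · obtain ⟨i₀, hi₀⟩ : ∃ i, f i ≠ l₀ := by
      by_contra h; push Not at h; exact hc (funext h)
    -- exponent ≥ m·d l₀ + d l₁
    have hge0 : ∀ i, d l₀ ≤ d (f i) := fun i => by
      by_cases h0 : f i = l₀
      · rw [h0]
      · by_cases h1 : f i = l₁
        · rw [h1]; exact h01.le
        · exact (h01.trans (hnext _ h0 h1)).le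
    have h1 : d l₁ ≤ d (f i₀) := by
      by_cases h1 : f i₀ = l₁
      · rw [h1]
      · exact (hnext _ hi₀ h1).le
    have hsplit := Finset.add_sum_erase Finset.univ (fun i => d (f i)) (Finset.mem_univ i₀)
    have hrest : (Finset.univ.erase i₀).card * d l₀ ≤ ∑ i ∈ Finset.univ.erase i₀, d (f i) := by
      rw [← smul_eq_mul, ← Finset.sum_const]
      exact Finset.sum_le_sum fun i _ => hge0 i
    rw [Finset.card_erase_of_mem (Finset.mem_univ _), Finset.card_univ, Fintype.card_fin, Nat.add_sub_cancel] at hrest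
    have hge : m * d l₀ + d l₁ ≤ ∑ i, d (f i) := by rw [← hsplit]; linarith
    have heq : m * d l₀ + d l₁ = ∑ i, d (f i) := le_antisymm hge (hf ▸ hle)
    exact hE1 (hf.symm.trans heq.symm)

end TrailingCoeffs

end Summit.ValiantsHypothesis.ValiantsHypothesis.Theorems.LacunarySymmetroidMatrixDescartes
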